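import Summits.BirchSwinnertonDyer.Rank1Residual.X1.RankOneCertificateRowsSha
import Summits.BirchSwinnertonDyer.Rank1Residual.X1.ParitySqueeze
import Literature.NumberTheory.EllipticCurves.SupersingularDensitySerreFrobeniusProofs
import HarnessLib

/-!
# X1: the anomalous factor is EXACT — `ord_p #Ẽ(𝔽_p) = 1` at every odd anomalous good prime

HONEST FRAMING (cell `b2b-bsdres`, run/shared/lean/b2b/bsd-rank1-residual/, verbatim in every
file): the goal of the cell is to DELETE the COMBINATION-SHAPED residual classes of the
Birch–Swinnerton-Dyer formula for ALL analytic-rank `≤ 1` elliptic curves over `ℚ` — "full BSD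
formula for every rank `≤ 1` curve in class `C`" assembled STRICTLY from published theorems — so
that the rank-`≤ 1` remainder becomes exactly the CONSTRUCTION-SHAPED classes, which are TYPED
(missing-input `Prop`s), NOT attempted. This is not "finishing BSD". CLASS-OWNERS.md: row
"X1 (r = 1)" — research route; NO CLAIM BEYOND STATED CLASSES; no label change; nothing is booked by
this file; no preprint enters; NO definition, NO named fact.

Unit `b2b-bsdres-x1a` (X1 prover A, gen 19). WHAT. Every squeeze of the X1 files (routes P, P₃, R,
R-CT₂, G, T, N, E: `ParitySqueeze`, `RankOneParitySqueezeLeaf`, `RankOneRegulatorSqueeze`,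
`RankOneCertificateRows(Sha)`, `ConstantTermSqueeze`, `FactorSqueezeHb`, …) carries the term
`2 * padicValNat p (W.reductionPointCount p)` — twice the `p`-adic valuation of `#Ẽ(𝔽_p)`, the
anomalous factor `(1 - α⁻¹)²` of the interpolation formula — and the tree only knew
`1 ≤ padicValNat p (W.reductionPointCount p)` on the leaf (`Leaf.one_le_padicValNat_reductionPointCount`).
In fact the valuation is EXACTLY `1`: at a good prime `p ≠ 2` with `a_p ≡ 1 (mod p)`, Hasse's bound
`a_p² ≤ 4p` leaves only `a_p = 1` (`#Ẽ(𝔽_p) = p`) or, for `p ∈ {3, 5}`, `a_p = 1 - p`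
(`#Ẽ(𝔽_p) = 2p`); in both cases `p ∥ #Ẽ(𝔽_p)` (§1). Consequences: on both leaves the anomalous term
of every squeeze is the CONSTANT `2` (§2), so the certificate dictionary of the lane offer
`class-closure/N1/OFFER-T-X1R1-RP1-x1a.md` loses its `v_Np` field (it is a theorem, not a datum), and
the extended row record `Leaf.bsdp_of_isIsogenous_of_certificateRowSha` (p305160) has the
evaluated form §3 (`hb : vc + 1 + 2·ord_p #E′(ℚ)_tors ≤ v + ord_p ∏c_ℓ(E′) + 2`, resp. `+ 4` on the
`Ш`-defect-2 branch). For `p ≥ 7` moreover `a_p = 1` and `#Ẽ(𝔽_p) = p` on the nose (§1).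

References: [SilvermanAEC2009] Thm. V.1.1 (Hasse); HOME/b2b-bsdres-x1a/X1-CHAIN.md §28.
-/

noncomputable section

open scoped Classical MatrixGroups ModularForm

open PowerSeries CongruenceSubgroup WeierstrassCurve Literature.NumberTheory.EllipticCurves
  Literature.NumberTheory.EllipticCurves.ModularForms
  Literature.NumberTheory.EllipticCurves.Wuthrich2014
  Literature.NumberTheory.EllipticCurves.Rank1Residual
  Summit.BirchSwinnertonDyer.BirchSwinnertonDyer.Theorems
  Summit.BirchSwinnertonDyer.BirchSwinnertonDyer.Theorems.Rank1ResidualX1Defs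
  Summit.BirchSwinnertonDyer.Rank1Residual.X1.RankOneLeadingTermSqueeze

set_option autoImplicit false

namespace Summit.BirchSwinnertonDyer.Rank1Residual.X1

variable {W : WeierstrassCurve ℚ} [W.IsElliptic] [W.IsGloballyMinimal] {p : ℕ} [Fact p.Prime]

/-! ## §1. Hasse's bound at an anomalous prime -/

/-- **At a good prime `p ≠ 2` with `a_p ≡ 1 (mod p)`, `#Ẽ(𝔽_p) ∈ {p, 2p}`.** `p ∣ #Ẽ(𝔽_p) = p + 1 - a_p`,
and Hasse's bound `a_p² ≤ 4p` excludes `#Ẽ(𝔽_p) = 0` (`a_p = p + 1`) and `#Ẽ(𝔽_p) ≥ 3p`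
(`a_p ≤ 1 - 2p`). [cite: SilvermanAEC2009, Thm. V.1.1] -/
theorem reductionPointCount_eq_or_eq_two_mul_of_anomalous (hp2 : p ≠ 2)
    (hgood : W.HasGoodReductionAtPrime p) (hanom : (p : ℤ) ∣ W.frobeniusTrace p - 1) :
    W.reductionPointCount p = p ∨ W.reductionPointCount p = 2 * p := by
  have hp : p.Prime := Fact.out
  have hp3 : 3 ≤ p := by have := hp.two_le; omega
  haveI : NeZero p := ⟨hp.ne_zero⟩
  have hsq := W.frobeniusTrace_sq_le_four_mul p hgood
  have hdvd : p ∣ W.reductionPointCount p :=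
    (dvd_reductionPointCount_iff_dvd_frobeniusTrace_sub_one W p).mpr hanom
  obtain ⟨k, hk⟩ := hdvd
  have ha : W.frobeniusTrace p = (p : ℤ) + 1 - (W.reductionPointCount p : ℤ) := rfl
  rw [ha, hk] at hsq
  push_cast at hsq
  -- `(p + 1 - k p)² ≤ 4p` forces `k ∈ {1, 2}`
  have hp3' : (3 : ℤ) ≤ p := by exact_mod_cast hp3
  have hk12 : k = 1 ∨ k = 2 := by
    rcases Nat.lt_or_ge k 3 with hlt | hge
    · interval_cases k
      · exfalso
        simp only [Nat.cast_zero, mul_zero, sub_zero] at hsq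
        nlinarith
      · exact Or.inl rfl
      · exact Or.inr rfl
    · exfalso
      have hk3 : (3 : ℤ) ≤ k := by exact_mod_cast hge
      have h1 : (2 : ℤ) * p - 1 ≤ (p : ℤ) * k - p - 1 := by nlinarith
      have h2 : ((p : ℤ) + 1 - p * k) ^ 2 = ((p : ℤ) * k - p - 1) ^ 2 := by ring
      rw [h2] at hsq
      nlinarith
  rcases hk12 with rfl | rfl
  · exact Or.inl (by rw [hk, mul_one])
  · exact Or.inr (by rw [hk, mul_comm])

/-- **`ord_p #Ẽ(𝔽_p) = 1` EXACTLY at a good anomalous prime `p ≠ 2`** (`#Ẽ(𝔽_p) ∈ {p, 2p}` and `p`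
is odd). [cite: SilvermanAEC2009, Thm. V.1.1] -/
theorem padicValNat_reductionPointCount_eq_one_of_anomalous (hp2 : p ≠ 2)
    (hgood : W.HasGoodReductionAtPrime p) (hanom : (p : ℤ) ∣ W.frobeniusTrace p - 1) :
    padicValNat p (W.reductionPointCount p) = 1 := by
  have hp : p.Prime := Fact.out
  rcases reductionPointCount_eq_or_eq_two_mul_of_anomalous hp2 hgood hanom with h | h
  · rw [h, padicValNat_self]
  · rw [h, padicValNat.mul (by norm_num) hp.ne_zero, padicValNat_self,
      padicValNat.eq_zero_of_not_dvd
        (fun h2 ↦ hp2 ((Nat.prime_dvd_prime_iff_eq hp Nat.prime_two).mp h2))]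

/-- **For `p ≥ 7`: `a_p = 1` at a good anomalous prime** (`a_p = 1 - p` would violate Hasse's bound:
`(p - 1)² > 4p` once `p ≥ 6`). [cite: SilvermanAEC2009, Thm. V.1.1] -/
theorem frobeniusTrace_eq_one_of_anomalous (h7 : 7 ≤ p) (hgood : W.HasGoodReductionAtPrime p)
    (hanom : (p : ℤ) ∣ W.frobeniusTrace p - 1) : W.frobeniusTrace p = 1 := by
  have hsq := W.frobeniusTrace_sq_le_four_mul p hgood
  have h7' : (7 : ℤ) ≤ p := by exact_mod_cast h7
  have ha : W.frobeniusTrace p = (p : ℤ) + 1 - (W.reductionPointCount p : ℤ) := rfl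
  rcases reductionPointCount_eq_or_eq_two_mul_of_anomalous (by omega) hgood hanom with h | h
  · rw [ha, h]; ring
  · exfalso
    rw [ha, h] at hsq
    push_cast at hsq
    nlinarith

/-- **For `p ≥ 7`: `#Ẽ(𝔽_p) = p` on the nose at a good anomalous prime.**
[cite: SilvermanAEC2009, Thm. V.1.1] -/
theorem reductionPointCount_eq_self_of_anomalous (h7 : 7 ≤ p) (hgood : W.HasGoodReductionAtPrime p)
    (hanom : (p : ℤ) ∣ W.frobeniusTrace p - 1) : W.reductionPointCount p = p := by
  have h := frobeniusTrace_eq_one_of_anomalous h7 hgood hanom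
  have ha : W.frobeniusTrace p = (p : ℤ) + 1 - (W.reductionPointCount p : ℤ) := rfl
  rw [ha] at h
  have : (W.reductionPointCount p : ℤ) = p := by linarith
  exact_mod_cast this

/-! ## §2. On the two leaves of X1 -/

/-- **Rank-one leaf: `ord_p #Ẽ(𝔽_p) = 1`** (sharpens `RankOne.Leaf.one_le_padicValNat_reductionPointCount`).
[cite: SilvermanAEC2009, Thm. V.1.1] -/
theorem RankOne.Leaf.padicValNat_reductionPointCount_eq_one (hL : RankOne.Leaf W p) :
    padicValNat p (W.reductionPointCount p) = 1 :=
  have hX := isClassX1_of_classX1 hL.1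
  padicValNat_reductionPointCount_eq_one_of_anomalous hX.two_ne hX.hasGoodReductionAtPrime
    hX.dvd_frobeniusTrace_sub_one

/-- **Rank-zero leaf: `ord_p #Ẽ(𝔽_p) = 1`** (sharpens `Leaf.one_le_padicValNat_reductionPointCount`).
[cite: SilvermanAEC2009, Thm. V.1.1] -/
theorem RankZero.Leaf.padicValNat_reductionPointCount_eq_one (hL : RankZero.Leaf W p) :
    padicValNat p (W.reductionPointCount p) = 1 :=
  have hX := isClassX1_of_classX1 hL.classX1
  padicValNat_reductionPointCount_eq_one_of_anomalous hX.two_ne hX.hasGoodReductionAtPrime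
    hX.dvd_frobeniusTrace_sub_one

/-- On the rank-one leaf the anomalous factor is `1` at every globally minimal curve of the isogeny
class (each is a leaf curve, `Leaf.of_isIsogenous`). [cite: SilvermanAEC2009, Thm. V.1.1] -/
theorem RankOne.Leaf.padicValNat_reductionPointCount_eq_one_of_isIsogenous (hL : RankOne.Leaf W p)
    {W' : WeierstrassCurve ℚ} [W'.IsElliptic] [W'.IsGloballyMinimal] (hiso : IsIsogenous W W') :
    padicValNat p (W'.reductionPointCount p) = 1 :=
  (hL.of_isIsogenous hiso).padicValNat_reductionPointCount_eq_one

/-! ## §3. The extended row record with the anomalous factor evaluated -/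

namespace RankOne

/-- **THE EXTENDED ROW RECORD (p305160) WITH THE ANOMALOUS TERM EVALUATED: booking (isogeny) form.**
A leaf pair `(E, p)` and a globally minimal `E′ ∼ E` carrying an extended certificate row — route P₁,
OR route R with the squeeze `vc + 1 + 2·ord_p #E′(ℚ)_tors ≤ v + ord_p ∏c_ℓ(E′) + 2`, OR route
R-CT₂ with `… ≤ v + ord_p ∏c_ℓ(E′) + 4` and one non-zero element of `Ш(E′)[p]` — ⇒ `BSD(E,p)`.
Same nine published binders; the per-row datum `ord_p #Ẽ′(𝔽_p)` of p305160 is replaced by the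
theorem `= 1` (§2). [cite: Wuthrich2014, Thm. 16 (p. 397)] [cite: BalakrishnanMullerStein2015, Thm. 1.7]
[cite: PerrinRiou1987, §1.4 Cor. 1.8] [cite: SilvermanAEC2009, Thm. X.4.14 and Thm. V.1.1]
[cite: MilneADT2006, Thm. I.7.3] -/
theorem Leaf.bsdp_of_isIsogenous_of_certificateRowSha_two
    (hW16 : Wuthrich2014.charIdeal_dvd_padicLFunction) (hS : Schneider1985_order_charGenerator_odd)
    (hPR : perrinRiou_rankOne_leadingTerms_odd) (hMT : mazur_tate_sigma_exists_odd)
    (hmod : nonempty_modularParametrizationData) (hmod' : hasEntireLFunction_rat)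
    (hGZK : rank_eq_analyticRank_of_analyticRank_le_one) (hCassels : bsdRHS_eq_of_isIsogenous)
    (hCT : exists_casselsTate_pairing (K := ℚ))
    (hL : Leaf W p) {W' : WeierstrassCurve ℚ} [W'.IsElliptic] [W'.IsGloballyMinimal]
    (hiso : IsIsogenous W W')
    (hrow : ((∀ [NeZero (W'.conductorNorm ℤ)] (f : CuspForm (Gamma0 (W'.conductorNorm ℤ)) 2),
        IsNewformOf W' f → ∀ (ϖ : ℚ), (ϖ : ℝ) * W'.realPeriodRat = plusPeriod f →
        ‖coeff 1 (C (ϖ : ℚ_[p]) * padicLFunction f (unitRoot W' p : ℚ_[p]))‖ = 1) ∨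
      (∃ vc v : ℤ, vc ≠ 0 ∧ AnalyticCoeffOneVal W' p vc ∧
        (∀ Dh : PAdicHeightData W' p, Dh.IsCanonical → v ≤ (padicRegulator Dh).valuation) ∧
        vc + 1 + 2 * padicValNat p W'.torsionOrder ≤ v + padicValNat p W'.tamagawaProduct + 2) ∨
      (∃ vc v : ℤ, vc ≠ 0 ∧ AnalyticCoeffOneVal W' p vc ∧
        (∀ Dh : PAdicHeightData W' p, Dh.IsCanonical → v ≤ (padicRegulator Dh).valuation) ∧
        vc + 1 + 2 * padicValNat p W'.torsionOrder ≤ v + padicValNat p W'.tamagawaProduct + 4 ∧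
        ∃ x : W'.sha, x ≠ 0 ∧ p • x = 0))) :
    BSDp W p := by
  have hN : (padicValNat p (W'.reductionPointCount p) : ℤ) = 1 := by
    exact_mod_cast hL.padicValNat_reductionPointCount_eq_one_of_isIsogenous hiso
  refine hL.bsdp_of_isIsogenous_of_certificateRowSha hW16 hS hPR hMT hmod hmod' hGZK hCassels hCT
    hiso ?_
  rcases hrow with h | ⟨vc, v, hvc, hc, hv, hb⟩ | ⟨vc, v, hvc, hc, hv, hb, hw⟩
  · exact Or.inl h
  · exact Or.inr (Or.inl ⟨vc, v, hvc, hc, hv, by rw [hN]; linarith⟩)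
  · exact Or.inr (Or.inr ⟨vc, v, hvc, hc, hv, by rw [hN]; linarith, hw⟩)

/-- **… and at the pair itself: an extended row with the anomalous term evaluated ⇒ Mazur's main
conjecture ∧ `BSD(E,p)`.** [cite: Wuthrich2014, Thm. 16 (p. 397)]
[cite: BalakrishnanMullerStein2015, Thm. 1.7] [cite: PerrinRiou1987, §1.4 Cor. 1.8]
[cite: SilvermanAEC2009, Thm. X.4.14 and Thm. V.1.1] -/
theorem Leaf.mazurMainConjecture_and_bsdp_of_certificateRowSha_two
    (hW16 : Wuthrich2014.charIdeal_dvd_padicLFunction) (hS : Schneider1985_order_charGenerator_odd)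
    (hPR : perrinRiou_rankOne_leadingTerms_odd) (hMT : mazur_tate_sigma_exists_odd)
    (hmod : nonempty_modularParametrizationData) (hGZK : rank_eq_analyticRank_of_analyticRank_le_one)
    (hCT : exists_casselsTate_pairing (K := ℚ)) (hL : Leaf W p)
    (hrow : ((∀ [NeZero (W.conductorNorm ℤ)] (f : CuspForm (Gamma0 (W.conductorNorm ℤ)) 2),
        IsNewformOf W f → ∀ (ϖ : ℚ), (ϖ : ℝ) * W.realPeriodRat = plusPeriod f →
        ‖coeff 1 (C (ϖ : ℚ_[p]) * padicLFunction f (unitRoot W p : ℚ_[p]))‖ = 1) ∨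
      (∃ vc v : ℤ, vc ≠ 0 ∧ AnalyticCoeffOneVal W p vc ∧
        (∀ Dh : PAdicHeightData W p, Dh.IsCanonical → v ≤ (padicRegulator Dh).valuation) ∧
        vc + 1 + 2 * padicValNat p W.torsionOrder ≤ v + padicValNat p W.tamagawaProduct + 2) ∨
      (∃ vc v : ℤ, vc ≠ 0 ∧ AnalyticCoeffOneVal W p vc ∧
        (∀ Dh : PAdicHeightData W p, Dh.IsCanonical → v ≤ (padicRegulator Dh).valuation) ∧
        vc + 1 + 2 * padicValNat p W.torsionOrder ≤ v + padicValNat p W.tamagawaProduct + 4 ∧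
        ∃ x : W.sha, x ≠ 0 ∧ p • x = 0))) :
    MazurMainConjecture W p ∧ BSDp W p := by
  have hN : (padicValNat p (W.reductionPointCount p) : ℤ) = 1 := by
    exact_mod_cast hL.padicValNat_reductionPointCount_eq_one
  refine hL.mazurMainConjecture_and_bsdp_of_certificateRowSha hW16 hS hPR hMT hmod hGZK hCT ?_
  rcases hrow with h | ⟨vc, v, hvc, hc, hv, hb⟩ | ⟨vc, v, hvc, hc, hv, hb, hw⟩
  · exact Or.inl h
  · exact Or.inr (Or.inl ⟨vc, v, hvc, hc, hv, by rw [hN]; linarith⟩)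
  · exact Or.inr (Or.inr ⟨vc, v, hvc, hc, hv, by rw [hN]; linarith, hw⟩)

end RankOne

end Summit.BirchSwinnertonDyer.Rank1Residual.X1

end
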